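import Mathlib
import Summits.Ventures.HodgeRepro.Tier4.Target
import Summits.Ventures.HodgeRepro.Tier4.Common.TargetData
import Summits.Ventures.HodgeRepro.Tier4.Line4.MixedTransfer
import Summits.Ventures.HodgeRepro.Tier4.Line4.MixedInvariant

/-!
# Tier4/Line4/PullbackWedge — the `(2,2)`-density `⟨ξ ∧ ξ′⟩` transforms by `|det J|²` under pull-back (SUPPORT)

Blind re-derivation cell `pub-hodge-repro`, Tier 4 (README §9–§10), seat t4-L4-p2 (prover, LINE L4, gen 0).  Tree path
`lean/Summits/Ventures/HodgeRepro/Tier4/Line4/PullbackWedge.lean`.  Imports, BY NAME, plan-4's `Line4/MixedTransfer`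
(p661007: `Form11`, `wedgeCoeff11`) and t4-L4-p1's `Line4/MixedInvariant` (p661725: `jacMat`, `pull`, `IsInvariant11`).

WHAT IS PROVED (pure algebra of `2 × 2` matrices; a SUPPORT lemma for L4.0′ `pair11_descends` and for the
independence of `pair11 D ξ ξ′` of the fundamental domain `D` — the two halves of the Stokes / unfolding machinery
of the `(1,1)`-side): `wedgeCoeff11_pull` — for ANY map `g`, `(1,1)`-forms `ξ, ξ′` and point `z`,
`⟨g^*ξ ∧ g^*ξ′⟩(z) = det J(z) · conj (det J(z)) · ⟨ξ ∧ ξ′⟩(g z)`, `J = jacMat g z` (the pull-back of the volume form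
`dz₀ ∧ dz₁ ∧ dz̄₀ ∧ dz̄₁` is `|det J|²` times itself); `wedgeCoeff11_act_of_invariant` — hence, for two `Γ′`-invariant
forms and `γ ∈ Γ′`, `z ∈ ball`: `|det J_γ(z)|² · ⟨ξ ∧ ξ′⟩(γ z) = ⟨ξ ∧ ξ′⟩(z)`, i.e. the density `⟨ξ ∧ ξ′⟩ dLeb` is
`Γ′`-invariant on the ball (the change-of-variables identity behind «the integral over a fundamental domain does not
depend on the domain»).

Nothing here says anything about the status of the Hodge conjecture for CM abelian varieties, which is NOT proved
(HC_CM is NOT proved by anyone in this repository).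
-/

set_option autoImplicit false

noncomputable section

open Matrix NumberField
open scoped ComplexConjugate

namespace Summit.Ventures.HodgeRepro.Tier4.Line4

open Summit.Ventures.HodgeRepro.Tier4

/-- **The `(2,2)`-density transforms by `|det J|²`**: for `2 × 2` matrices `J, A, B`,
`⟨(Jᵀ A J̄) ∧ (Jᵀ B J̄)⟩ = det J · conj (det J) · ⟨A ∧ B⟩`. -/
theorem wedgeCoeff11_transpose_mul_mul_conjMap (J A B : Matrix (Fin 2) (Fin 2) ℂ) :
    wedgeCoeff11 (Jᵀ * A * J.map (starRingEnd ℂ)) (Jᵀ * B * J.map (starRingEnd ℂ)) =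
      J.det * conj J.det * wedgeCoeff11 A B := by
  simp only [wedgeCoeff11, Matrix.mul_apply, Matrix.transpose_apply, Matrix.map_apply, Fin.sum_univ_two,
    Matrix.det_fin_two, map_sub, map_mul]
  ring

/-- **Pull-back of the `(2,2)`-density**: `⟨g^*ξ ∧ g^*ξ′⟩(z) = det J(z) · conj (det J(z)) · ⟨ξ ∧ ξ′⟩(g z)`. -/
theorem wedgeCoeff11_pull (g : (Fin 2 → ℂ) → (Fin 2 → ℂ)) (ξ ξ' : (Fin 2 → ℂ) → Form11) (z : Fin 2 → ℂ) :
    wedgeCoeff11 (pull g ξ z) (pull g ξ' z) =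
      (jacMat g z).det * conj (jacMat g z).det * wedgeCoeff11 (ξ (g z)) (ξ' (g z)) :=
  wedgeCoeff11_transpose_mul_mul_conjMap _ _ _

variable {F E : Type} [Field F] [NumberField F] [IsGalois ℚ F] [IsCMField F]
  [Field E] [NumberField E] [IsGalois ℚ E] [IsCMField E] (d : TargetData F E)

/-- **The density of two `Γ′`-invariant `(1,1)`-forms is `Γ′`-invariant on the ball**:
`|det J_γ(z)|² · ⟨ξ ∧ ξ′⟩(γ z) = ⟨ξ ∧ ξ′⟩(z)` for `γ ∈ Γ′`, `z ∈ ball`. -/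
theorem wedgeCoeff11_act_of_invariant {Γ' : Set (Matrix (Fin 3) (Fin 3) E)} {ξ ξ' : (Fin 2 → ℂ) → Form11}
    (hξ : IsInvariant11 d Γ' ξ) (hξ' : IsInvariant11 d Γ' ξ') {γ : Matrix (Fin 3) (Fin 3) E} (hγ : γ ∈ Γ')
    {z : Fin 2 → ℂ} (hz : z ∈ ball) :
    (jacMat (d.act γ) z).det * conj (jacMat (d.act γ) z).det * wedgeCoeff11 (ξ (d.act γ z)) (ξ' (d.act γ z)) =
      wedgeCoeff11 (ξ z) (ξ' z) := by
  rw [← wedgeCoeff11_pull, hξ γ hγ z hz, hξ' γ hγ z hz]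

end Summit.Ventures.HodgeRepro.Tier4.Line4

end
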